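import Summits.ResolutionOfSingularities.ResolutionOfSingularities.Theorems.WeightedInvariantHypersurfaceLocalGameEFTPointMoveDrop
import Summits.ResolutionOfSingularities.ResolutionOfSingularities.Theorems.WeightedInvariantP3aTieLocusPin
import Summits.ResolutionOfSingularities.ResolutionOfSingularities.Theorems.WeightedInvariantKWildHomDrop
import Summits.ResolutionOfSingularities.ResolutionOfSingularities.Theorems.WeightedInvariantIota3IsoSuccHeightOne
import HarnessLib

/-!
# Point moves IV: the rank drops at every prime STRICTLY BELOW a `t`-homogeneous successor when the face polynomial has order `< ν`
# along the CURVES of the weighted plane (door `HypersurfaceCentreConstruction`, stmt-ResolutionOfSingularities-19897; stub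
# `stub_keyRungGrHomLE_three`, residual (D-b³-point-STAT) of …KeyRungThreeOfDropPointStat; (iso-succ) PART C programme, B-side)

Topic: `Summits/ResolutionOfSingularities/ResolutionOfSingularities/Theorems`.  DEF-FREE.  Helper `--supports stmt-ResolutionOfSingularities-19897`.

Sequel of …PointMoveDrop (`pointMove_iotaOrd_lt_of_face`, p-landed: the rank drops at EVERY successor prime when the face polynomial has order `< ν`
at every prime off the vertex) for the ORDER-STATIONARY analysis of (D-b³-point-STAT): the letter `ε` of `ι₀ = (ν ; ε ; τ)` at a `t`-homogeneous
successor `𝔫₁` reads the equimultiple locus of the transform in `Spec B_{𝔫₁}`, i.e. the primes `𝔫 < 𝔫₁`.  Those NOT containing `t⁻¹` see the order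
downstairs (…IotaOrderOffExceptional); those containing `t⁻¹` are treated here:

* `map_rho_le_span_X_of_isTHomogeneous` — for a `t`-HOMOGENEOUS proper ideal `𝔫₁` of `B = S[t⁻¹, 𝒥ₙtⁿ]` (point centre, all weights positive) the image
  `ρ(𝔫₁) ⊆ κ[X]` lies in the irrelevant ideal `(X₁, …, X_d)`: a `t`-homogeneous element is a Laurent monomial `a tᵐ` (…P3aTieLocusPin); for `m > 0` it
  lies in the vertex ideal (`↦ (X)`), for `m = 0` it is `a ∈ 𝔪` (else a unit) `↦ ā = 0`, for `m < 0` it is `a (t⁻¹)^{|m|} ↦ 0`.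
* `span_X_ne_top` — `(X) ≠ ⊤` (the constant coefficient).
* `nbar_lt_nbar`, `nbar_lt_span_X`, `height_nbar_le_one` — for primes `t⁻¹ ∈ 𝔫 < 𝔫₁` with `𝔫₁` `t`-homogeneous and off the vertex: `height ρ(𝔫) ≤ 1` (`ρ(𝔫) < ρ(𝔫₁) < (X) ≤ 𝔐`,
  `dim κ[X₀,X₁,X₂] = 3`; …IsoSuccHeightOne's `height_le_one_of_lt_of_lt`).
* **`pointMove_iotaOrd_lt_below_of_face`** — setting of …PointMoveChart (`f = Σ_{α∈Δ} a_α u^α + r`, face polynomial `Φ = ρ(G)`), `d ≤ 3`, `ν ≥ 1`: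
  IF `Φ ∉ 𝔫'^ν κ[X]_{𝔫'}` for every NON-ZERO prime `𝔫'` of HEIGHT `≤ 1` (the curves of the weighted plane — supplied at a σ-maximiser presentation by
  …IsoSuccHeightOne + PART B′, next hand), THEN at every prime `𝔫 ∋ t⁻¹` lying STRICTLY BELOW a `t`-homogeneous off-vertex prime `𝔫₁`, every
  factorisation `f = (t⁻¹)ᵃ g`, `t⁻¹ ∤ g`, has `iotaOrd B_𝔫 (g/1) < ν`.  (At `ρ(𝔫) = 0`, i.e. `𝔫 = (t⁻¹)`, `g` is a unit at `𝔫`.)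

[OURS · L1 W4.3 · audit glue / folklore bookkeeping; AI work, weaker than expert review; nothing here is a statement of the manuscript under review
(Hironaka 2017, [claim: Hironaka2017, status: under-review]).]

## References

* J. Włodarczyk, *Functorial resolution by torus actions*, arXiv:2203.03090, §2.3.9, §3.3. [Wlodarczyk2022]
* H. Matsumura, *Commutative Ring Theory*, CUP 1986, §5. [Matsumura1987]
-/

noncomputable section

open IsLocalRing Literature.AlgebraicGeometry.Resolution
open scoped LaurentPolynomial
open Summit.ResolutionOfSingularities.ResolutionOfSingularities.Cruxes.HypersurfaceCentreConstruction.LocalEngine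
  (iotaOrd IsTHomogeneous)
open Summit.ResolutionOfSingularities.ResolutionOfSingularities.Cruxes.HypersurfaceCentreConstruction.LocalEngine.Iota3
  (height_le_one_of_lt_of_lt)

set_option linter.dupNamespace false -- mandated namespace of this single-conjunct summit

namespace Summit.ResolutionOfSingularities.ResolutionOfSingularities.Theorems

namespace LocalGameEFTPointMove

variable {S : Type} [CommRing S] [IsRegularLocalRing S] {d : ℕ} (u : Fin d → S) (w : Fin d → ℕ)
  (hu : Ideal.span (Set.range u) = maximalIdeal S) (hd : (maximalIdeal S).spanFinrank = d) (hw : ∀ i, 0 < w i)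

/-! ## `t`-homogeneous ideals map into the irrelevant ideal -/

include hu hd hw in
/-- The vertex ideal maps into `(X₁, …, X_d)` under the exceptional chart. [folklore] -/
theorem map_rho_vertexIdeal_le_span_X :
    (extReesAlgebra.vertexIdeal (weightedMonomialIdeal u w)).map (rho u w hu hd hw) ≤
      Ideal.span (Set.range (MvPolynomial.X : Fin d → MvPolynomial (Fin d) (S ⧸ Ideal.span (Set.range u)))) := by
  rw [Ideal.map_le_iff_le_comap]
  refine (vertexIdeal_le_span_range_uT u w).trans ?_
  rw [Ideal.span_le]
  rintro _ ⟨i, rfl⟩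
  rw [SetLike.mem_coe, Ideal.mem_comap, rho_uT]
  exact Ideal.subset_span ⟨i, rfl⟩

include hu hd hw in
/-- **A `t`-homogeneous proper ideal maps into the irrelevant ideal `(X₁, …, X_d)`** (point centre: `(u) = 𝔪`, all weights positive).
[folklore] -/
theorem map_rho_le_span_X_of_isTHomogeneous (𝔫 : Ideal (extReesAlgebra (weightedMonomialIdeal u w))) (h𝔫 : 𝔫 ≠ ⊤)
    (hhom : IsTHomogeneous u w 𝔫) :
    𝔫.map (rho u w hu hd hw) ≤
      Ideal.span (Set.range (MvPolynomial.X : Fin d → MvPolynomial (Fin d) (S ⧸ Ideal.span (Set.range u)))) := by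
  unfold IsTHomogeneous at hhom
  conv_lhs => rw [← hhom]
  rw [Ideal.map_span, Ideal.span_le]
  rintro _ ⟨b, ⟨hb𝔫, hbhom⟩, rfl⟩
  rw [SetLike.mem_coe]
  obtain ⟨m, a, hba⟩ := LocalGameEFTCylinder.exists_coe_eq_single_of_isHomogeneousElem u w hbhom
  by_cases hm0 : m = 0
  · -- degree `0`: `b = a ∈ S`, and `a ∈ 𝔪` (else `b` is a unit and `𝔫 = ⊤`)
    subst hm0
    have hb : b = algebraMap S _ a := by
      apply Subtype.ext
      rw [hba, Subalgebra.coe_algebraMap, ← LaurentPolynomial.C_eq_algebraMap, LaurentPolynomial.T_zero, mul_one]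
    have ha : a ∈ maximalIdeal S := by
      by_contra ha
      have hua : IsUnit a := by simpa [IsLocalRing.mem_maximalIdeal, mem_nonunits_iff] using ha
      exact h𝔫 (Ideal.eq_top_of_isUnit_mem _ hb𝔫 (hb ▸ hua.map _))
    rw [hb, rho_algebraMap, Ideal.Quotient.eq_zero_iff_mem.mpr (hu ▸ ha : a ∈ Ideal.span (Set.range u)), map_zero]
    exact Ideal.zero_mem _
  obtain ⟨n, rfl | rfl⟩ := Int.eq_nat_or_neg m
  · -- positive degree: `b = a tⁿ` lies in the vertex ideal
    have hn : 0 < n := by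
      rcases Nat.eq_zero_or_pos n with h | h
      · exact absurd (by rw [h, Nat.cast_zero]) hm0
      · exact h
    have hbv : b ∈ extReesAlgebra.vertexIdeal (weightedMonomialIdeal u w) :=
      Ideal.subset_span ⟨n, hn, a, LocalGameEFTCylinder.mem_weightedMonomialIdeal_of_coe_eq u w hba, hba⟩
    exact map_rho_vertexIdeal_le_span_X u w hu hd hw (Ideal.mem_map_of_mem _ hbv)
  · -- negative degree: `b = a (t⁻¹)ⁿ ↦ 0`
    have hn : 0 < n := by
      rcases Nat.eq_zero_or_pos n with h | h
      · exact absurd (by rw [h, Nat.cast_zero, neg_zero]) hm0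
      · exact h
    rw [LocalGameEFTCylinder.eq_algebraMap_mul_tInv_pow_of_coe_eq u w hba, map_mul, map_pow, rho_tInv,
      zero_pow hn.ne', mul_zero]
    exact Ideal.zero_mem _

include hu in
/-- `(X₁, …, X_d) ≠ ⊤` in `κ[X]` (`κ = S ⧸ (u) = S ⧸ 𝔪 ≠ 0`). [folklore] -/
theorem span_X_ne_top :
    Ideal.span (Set.range (MvPolynomial.X : Fin d → MvPolynomial (Fin d) (S ⧸ Ideal.span (Set.range u)))) ≠ ⊤ := by
  haveI : (Ideal.span (Set.range u)).IsMaximal := by rw [hu]; exact IsLocalRing.maximalIdeal.isMaximal S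
  haveI : Nontrivial (S ⧸ Ideal.span (Set.range u)) := Ideal.Quotient.nontrivial_iff.mpr Ideal.IsPrime.ne_top'
  have hle : Ideal.span (Set.range (MvPolynomial.X : Fin d → MvPolynomial (Fin d) (S ⧸ Ideal.span (Set.range u)))) ≤
      RingHom.ker (MvPolynomial.constantCoeff : MvPolynomial (Fin d) (S ⧸ Ideal.span (Set.range u)) →+* _) := by
    rw [Ideal.span_le]
    rintro _ ⟨i, rfl⟩
    rw [SetLike.mem_coe, RingHom.mem_ker, MvPolynomial.constantCoeff_X]
  intro htop
  have h1 := hle (htop ▸ Submodule.mem_top : (1 : MvPolynomial (Fin d) (S ⧸ Ideal.span (Set.range u))) ∈ _)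
  rw [RingHom.mem_ker, map_one] at h1
  exact one_ne_zero h1

/-! ## Heights below a `t`-homogeneous successor -/

section Height

variable (𝔫 𝔫₁ : Ideal (extReesAlgebra (weightedMonomialIdeal u w))) [𝔫.IsPrime] [𝔫₁.IsPrime]
  (hT : extReesAlgebra.tInv (weightedMonomialIdeal u w) ∈ 𝔫) (hlt : 𝔫 < 𝔫₁)
  (hhom : IsTHomogeneous u w 𝔫₁) (hV : ¬ extReesAlgebra.vertexIdeal (weightedMonomialIdeal u w) ≤ 𝔫₁)

omit [𝔫.IsPrime] [𝔫₁.IsPrime] in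
include hu hd hw hT hlt in
/-- `ρ(𝔫) < ρ(𝔫₁)` for `t⁻¹ ∈ 𝔫 < 𝔫₁` (`ρ⁻¹ρ = id` on ideals containing `t⁻¹`). [folklore] -/
theorem nbar_lt_nbar : nbar u w hu hd hw 𝔫 < nbar u w hu hd hw 𝔫₁ := by
  refine lt_of_le_of_ne (Ideal.map_mono hlt.le) fun h => hlt.ne ?_
  rw [← comap_rho_nbar u w hu hd hw 𝔫 hT, ← comap_rho_nbar u w hu hd hw 𝔫₁ (hlt.le hT)]
  exact congrArg _ h

omit [𝔫.IsPrime] in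
include hu hd hw hlt hT hhom hV in
/-- `ρ(𝔫₁) < (X)` for a `t`-homogeneous off-vertex prime `𝔫₁ ∋ t⁻¹`. [folklore] -/
theorem nbar_lt_span_X :
    nbar u w hu hd hw 𝔫₁ <
      Ideal.span (Set.range (MvPolynomial.X : Fin d → MvPolynomial (Fin d) (S ⧸ Ideal.span (Set.range u)))) :=
  lt_of_le_of_ne (map_rho_le_span_X_of_isTHomogeneous u w hu hd hw 𝔫₁ Ideal.IsPrime.ne_top' hhom)
    fun h => not_span_X_le_nbar u w hu hd hw 𝔫₁ (hlt.le hT) hV h.ge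

include hu hd hw hT hlt hhom hV in
/-- **`height ρ(𝔫) ≤ 1`** for primes `t⁻¹ ∈ 𝔫 < 𝔫₁`, `𝔫₁` `t`-homogeneous and off the vertex, when `d ≤ 3`: the chain
`ρ(𝔫) < ρ(𝔫₁) < (X) ≤ 𝔐` in `κ[X]` of dimension `d ≤ 3`. [folklore] -/
theorem height_nbar_le_one (hd3 : d ≤ 3) : (nbar u w hu hd hw 𝔫).height ≤ 1 := by
  haveI : (Ideal.span (Set.range u)).IsMaximal := by rw [hu]; exact IsLocalRing.maximalIdeal.isMaximal S
  letI : Field (S ⧸ Ideal.span (Set.range u)) := Ideal.Quotient.field _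
  haveI := nbar_isPrime u w hu hd hw 𝔫 hT
  haveI := nbar_isPrime u w hu hd hw 𝔫₁ (hlt.le hT)
  obtain ⟨M, hM, hXM⟩ := Ideal.exists_le_maximal _ (span_X_ne_top u hu)
  haveI := hM.isPrime
  exact height_le_one_of_lt_of_lt hd3 (nbar_lt_nbar u w hu hd hw 𝔫 𝔫₁ hT hlt)
    ((nbar_lt_span_X u w hu hd hw 𝔫 𝔫₁ hT hlt hhom hV).trans_le hXM)

end Height

/-! ## The rank drops strictly below a `t`-homogeneous successor -/

include hu hd hw in
/-- **The rank drops at every prime `t⁻¹ ∈ 𝔫` strictly below a `t`-homogeneous off-vertex successor prime when the face polynomial has order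
`< ν` along every curve of the weighted plane** (`d ≤ 3`, `ν ≥ 1`). [OURS · L1 W4.3 · K7a-below] -/
theorem pointMove_iotaOrd_lt_below_of_face (hd3 : d ≤ 3) (Δ : Finset (Fin d → ℕ)) (a : (Fin d → ℕ) → S) (m : ℕ) {N : ℕ}
    (hN : 0 < N) {r : S} (hr : r ∈ (maximalIdeal S) ^ N) (hm : ∀ α ∈ Δ, m ≤ ∑ i, w i * α i) (hmN : m < N)
    {f : S} (hf : f = ∑ α ∈ Δ, a α * ∏ i, u i ^ α i + r) {ν : ℕ} (hν : 0 < ν)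
    (hface : ∀ (𝔫' : Ideal (MvPolynomial (Fin d) (S ⧸ Ideal.span (Set.range u)))) [𝔫'.IsPrime],
      𝔫' ≠ ⊥ → 𝔫'.height ≤ 1 →
      algebraMap (MvPolynomial (Fin d) (S ⧸ Ideal.span (Set.range u))) (Localization.AtPrime 𝔫')
        (rho u w hu hd hw (transform u w hu hw Δ a m hN hr)) ∉ maximalIdeal (Localization.AtPrime 𝔫') ^ ν) :
    ∀ (𝔫 : Ideal (extReesAlgebra (weightedMonomialIdeal u w))) [𝔫.IsPrime],
      extReesAlgebra.tInv (weightedMonomialIdeal u w) ∈ 𝔫 →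
      ∀ (𝔫₁ : Ideal (extReesAlgebra (weightedMonomialIdeal u w))) [𝔫₁.IsPrime], 𝔫 < 𝔫₁ → IsTHomogeneous u w 𝔫₁ →
      ¬ (extReesAlgebra.vertexIdeal (weightedMonomialIdeal u w) ≤ 𝔫₁) →
      ∀ (a' : ℕ) (g : extReesAlgebra (weightedMonomialIdeal u w)),
        algebraMap S (extReesAlgebra (weightedMonomialIdeal u w)) f =
          extReesAlgebra.tInv (weightedMonomialIdeal u w) ^ a' * g →
        ¬ (extReesAlgebra.tInv (weightedMonomialIdeal u w) ∣ g) →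
        iotaOrd (Localization.AtPrime 𝔫)
          (algebraMap (extReesAlgebra (weightedMonomialIdeal u w)) (Localization.AtPrime 𝔫) g) < ν := by
  intro 𝔫 _ hT 𝔫₁ _ hlt hhom hV a' g hfg hndvd
  haveI := nbar_isPrime u w hu hd hw 𝔫 hT
  by_cases hbot : nbar u w hu hd hw 𝔫 = ⊥
  · -- `𝔫 = ρ⁻¹(0) = (t⁻¹)` does not contain `g`: `g` is a unit at `𝔫`
    have h𝔫 : 𝔫 = Ideal.span {extReesAlgebra.tInv (weightedMonomialIdeal u w)} := by
      rw [← comap_rho_nbar u w hu hd hw 𝔫 hT, hbot, ← RingHom.ker_eq_comap_bot, ker_rho]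
    have hg : g ∉ 𝔫 := by
      rw [h𝔫, Ideal.mem_span_singleton]
      exact hndvd
    apply LocalGameEFTFace.iotaOrd_lt_of_notMem_pow
    intro hmem
    have hunit : IsUnit (algebraMap _ (Localization.AtPrime 𝔫) g) :=
      IsLocalization.map_units (Localization.AtPrime 𝔫) ⟨g, show g ∈ 𝔫.primeCompl from hg⟩
    exact (IsLocalRing.maximalIdeal.isMaximal _).ne_top
      (Ideal.eq_top_of_isUnit_mem _ (Ideal.pow_le_self hν.ne' hmem) hunit)
  · have hht := height_nbar_le_one u w hu hd hw 𝔫 𝔫₁ hT hlt hhom hV hd3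
    have hΦ := hface (nbar u w hu hd hw 𝔫) hbot hht
    have hΦ0 : rho u w hu hd hw (transform u w hu hw Δ a m hN hr) ≠ 0 := by
      intro h0
      apply hΦ
      rw [h0, map_zero]
      exact Ideal.zero_mem _
    obtain ⟨-, rfl⟩ := transform_unique u w hu hd hw Δ a m hN hr hm hmN hf hΦ0 hfg hndvd
    refine lt_of_le_of_lt (iotaOrd_localization_le_of_comap_eq (rho u w hu hd hw) 𝔫 (nbar u w hu hd hw 𝔫)
      (comap_rho_nbar u w hu hd hw 𝔫 hT).symm _) ?_
    exact LocalGameEFTFace.iotaOrd_lt_of_notMem_pow hΦ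

end LocalGameEFTPointMove

end Summit.ResolutionOfSingularities.ResolutionOfSingularities.Theorems

end
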